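import Summits.CriticalPhenomena.Ising3DConformalLimit.Theses.LeeYangGap
import Summits.CriticalPhenomena.Ising3DConformalLimit.Theorems.LeeYangGapNearCriticalLeeYangGapCorrLengthUnbounded
import Summits.CriticalPhenomena.Ising3DConformalLimit.Theorems.LeeYangGapNearCriticalLeeYangGapCriticalWindowVarianceReductions
import Summits.CriticalPhenomena.Ising3DConformalLimit.Theorems.LeeYangGapNearCriticalLeeYangGapFirstZeroAttained
import Summits.CriticalPhenomena.Ising3DConformalLimit.Theorems.LeeYangGapNearCriticalLeeYangGapCubeZeroToFreeBox
import Summits.CriticalPhenomena.Ising3DConformalLimit.Theorems.LeeYangGapNearCriticalLeeYangGapBlockZeroOfFreeBoxZeros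
import Summits.CriticalPhenomena.Ising3DConformalLimit.Theorems.LeeYangGapNearCriticalLeeYangGapEdgeAnalyticity
import Summits.CriticalPhenomena.Ising3DConformalLimit.Theorems.LeeYangGapNearCriticalLeeYangGapSusceptibilityDoubling

/-!
# Near-critical Lee–Yang gap — the reduction GAP ⇐ EDGE + FirstZeroRate + SusceptibilityComparabilityOneScale

Route `LeeYangGap` (Ising3DConformalLimit), crux `NearCriticalLeeYangGap` (GAP, item
stmt-CriticalPhenomena-4945), line `registered` (tree `Cruxes/NearCriticalLeeYangGap/Lines/birth.lean`).
This file lands, as a sorry-free theorem of the tree, the COMPOSITION of that line — registered on the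
item as the glue stub S3 `stub_gapOfEdgeRateOneScale` (skeleton v7, lead c4; last declaration of this
file, exact registered signature): the crux decl
`Summit.CriticalPhenomena.Ising3DConformalLimit.Theses.LeeYangGap.NearCriticalLeeYangGap` follows from

* EDGE — the route item `YangLeeEdgeHyperscaling` (stmt-CriticalPhenomena-4946), taken BY NAME as a
  hypothesis (so the theorem is conditional on that open item and credits nothing towards it);
* S1r — the registered stub statement `stub_firstZeroRate`, verbatim, as a hypothesis: there are
  `A, K₀ > 0`, `β₀ < β_c(3)` with `α₁(Λ_L,β) ≤ A·α₁(Λ_n,β)` for all `n`, all `β ∈ [β₀,β_c)` and all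
  `L ≥ K₀ξ(β)` (`α₁(Λ,β) = JiangNewman.firstZero 3 Λ β`, the first Lee–Yang zero of the free cube; the
  lower half of the Itzykson–Pearson–Zuber finite-size scaling of partition-function zeros — OPEN);
* S2χ₁ — the registered stub statement `stub_susceptibilityComparabilityOneScale`, verbatim, as a
  hypothesis: there are `r, A > 0`, `β₂ < β_c(3)` with `Σ_{z ∈ Λ_n} ⟨σ₀σ_z⟩⁺_{β_c} ≤ A·χ(β)` for
  `β ∈ [β₂,β_c)`, `n ≤ rξ(β)` (near-critical one-scale susceptibility comparability, the amplitude form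
  of the Fisher half `γ ≥ (2−η)ν` — OPEN on `ℤ³`);

the seven remaining pieces of the line being the landed theorems of this namespace, discharged
inside the proof: S1u `stub_corrLengthUnbounded` (p149697), S2g
`stub_criticalWindowVariance_of_susceptibilityComparability` (p149939), S1t
`stub_blockZeroOfFreeBoxZeros` (p153642), S1a `stub_firstZeroAttained` (p153649), S1v
`stub_cubeZeroToFreeBox` (p154053), S1e `stub_edgeAnalyticity` (p154953), S2d
`stub_susceptibilityComparability_of_oneScale` (p155937).  Nothing open is proved, assumed as an
axiom, or restated as a definition here: the two open cores appear only as explicit hypotheses, with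
exactly the registered signatures, so that items filed for them plug in by `exact`.

Notation: `Λ_L = box 3 L` (`|Λ_L| = (2L+1)³`), `ξ(β) = isingCorrLength 3 β`, `χ(β) = susceptibility 3 β`
(`ℝ≥0∞`, read through `.toReal`), `m(β,h) = magnetizationInField 3 β h`, `Σ_L = ⟨M_L²⟩_{β_c}`
(`plusExpect 3 β_c 0`), `φ_{L,β}(θ) = ⟨cos(θ M_L)⟩_β`, `α₁(Λ_L,β) = JiangNewman.firstZero 3 (box 3 L) β`.

**Proof** (the line's bookkeeping `θ'²Σ_L ≤ α²·Bχξ³ = (A/c)²B·(cα/A)²χξ³ ≤ (A/c)²BC₁`). Constants: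
`C₁, β₀` (EDGE), `A, K₀, β₀'` (S1r), `c, β₀''` (S1e), `B, β₂` (S2g ∘ S2d ∘ S2χ₁ at window constant
`K₀ + 1`); `β₁ := max(β₀, β₀', β₀'', β₂, β_c/2) < β_c` (`β_c(3) > 0`). Given `L₀`, S1u yields
`β ∈ [β₁, β_c)` with `ξ(β) ≥ max(1, L₀/K₀ + 1)`; `L := ⌈K₀ξ(β)⌉₊` has `L₀ ≤ L`, `K₀ξ ≤ L ≤ (K₀+1)ξ`.
S1a: `α := α₁(Λ_L,β) > 0` is a zero of the free cube; S1v moves it to zeros `≤ α` of the block in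
every larger free box, S1t to a zero `θ' ∈ (0, α]` of the infinite-volume `φ_{L,β}` (`0 ≤ β ≤ β_c`);
S1r: `α/A ≤ α₁(Λ_n,β)` for all `n`; S1e: `m(β,·)` is analytic on `{|Im h| < cα/A}`; EDGE at `cα/A`:
`(cα/A)²χξ³ ≤ C₁`, hence `(θ'/(A/c))²χξ³ ≤ C₁`; S2 at `(β, L)`: `Σ_L ≤ Bχξ³`; so
`θ'²Σ_L ≤ (A/c)²BC₁ =: C`, with `L ≥ L₀` arbitrary — `∃ᶠ L`.

## References

* C. Itzykson, R. B. Pearson, J. B. Zuber, Nucl. Phys. B220 (1983) 415–433 [ItzyksonPearsonZuber1983]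
  (finite-size scaling of Lee–Yang zeros, the physics behind S1r).
* J. Jiang, C. M. Newman, CPAM 77 (2024), Thm. 1 [JiangNewman2023]; F. Camia, J. Jiang, C. M. Newman,
  arXiv:2207.12247, Thm. 2 [CamiaJiangNewman2023].
* H. Duminil-Copin, R. Panis, Comm. Math. Phys. 406 (2025), arXiv:2404.05700 [DuminilCopinPanis2025LowerBounds]
  (sharp length; the `d ≥ 5` analogue of S2χ₁).
* M. E. Fisher, Phys. Rev. 180 (1969) 594 (`γ ≤ (2−η)ν`); S. Friedli, Y. Velenik, CUP 2017, §3.7.4 [FriedliVelenik2017].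
-/

noncomputable section

namespace Summit.CriticalPhenomena.Ising3DConformalLimit.LeeYangGapNearCriticalLeeYangGap

open Filter
open Literature.Probability.LatticeModels
open Summit.CriticalPhenomena.Ising3DConformalLimit.Theses.LeeYangGap
  (NearCriticalLeeYangGap YangLeeEdgeHyperscaling)

/-! ### Arithmetic of the composition -/

/-- The inequality bookkeeping of the composition: from `S ≤ B·χ·ξ₃` and `(θ/A)²·χ·ξ₃ ≤ C₁` (with
`A, B > 0`) get `θ²·S ≤ A²·B·C₁`. -/
theorem gap_sq_mul_le_of_window_of_edge {A B C₁ θ S χ ξ₃ : ℝ} (hA : 0 < A) (hB : 0 < B)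
    (hS : S ≤ B * χ * ξ₃) (hE : (θ / A) ^ 2 * χ * ξ₃ ≤ C₁) :
    θ ^ 2 * S ≤ A ^ 2 * B * C₁ := by
  have h1 : θ ^ 2 * S ≤ θ ^ 2 * (B * χ * ξ₃) := mul_le_mul_of_nonneg_left hS (sq_nonneg θ)
  have h2 : θ ^ 2 * (B * χ * ξ₃) = A ^ 2 * B * ((θ / A) ^ 2 * χ * ξ₃) := by
    have hA' : A ≠ 0 := hA.ne'
    field_simp
  have h3 : A ^ 2 * B * ((θ / A) ^ 2 * χ * ξ₃) ≤ A ^ 2 * B * C₁ :=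
    mul_le_mul_of_nonneg_left hE (by positivity)
  linarith

/-- Choice of the block size: if `K₀ > 0`, `1 ≤ ξ`, `L₀/K₀ + 1 ≤ ξ`, then `L := ⌈K₀ξ⌉₊` satisfies
`L₀ ≤ L`, `K₀ξ ≤ L` and `L ≤ (K₀ + 1)ξ`. -/
theorem gap_blockSize_window {K₀ ξ : ℝ} {L₀ : ℕ} (hK₀ : 0 < K₀) (hξ1 : 1 ≤ ξ)
    (hξL : (L₀ : ℝ) / K₀ + 1 ≤ ξ) :
    L₀ ≤ ⌈K₀ * ξ⌉₊ ∧ K₀ * ξ ≤ (⌈K₀ * ξ⌉₊ : ℕ) ∧ ((⌈K₀ * ξ⌉₊ : ℕ) : ℝ) ≤ (K₀ + 1) * ξ := by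
  have hξ0 : 0 ≤ ξ := zero_le_one.trans hξ1
  have hceil : K₀ * ξ ≤ (⌈K₀ * ξ⌉₊ : ℕ) := Nat.le_ceil _
  have hlt : ((⌈K₀ * ξ⌉₊ : ℕ) : ℝ) < K₀ * ξ + 1 := Nat.ceil_lt_add_one (by positivity)
  refine ⟨?_, hceil, by nlinarith⟩
  have h1 : (L₀ : ℝ) ≤ K₀ * ξ := by
    have h := mul_le_mul_of_nonneg_left hξL hK₀.le
    rw [mul_add, mul_div_cancel₀ _ hK₀.ne', mul_one] at h
    linarith
  exact_mod_cast h1.trans hceil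

/-- Monotonicity of the edge quantity in the zero: if `0 < θ' ≤ α`, `0 ≤ χ`, `0 ≤ ξ₃` and
`(α/A')²·χ·ξ₃ ≤ C₁` then `(θ'/A')²·χ·ξ₃ ≤ C₁` (`A' > 0`). -/
theorem gap_edge_mono {A' θ' α χ ξ₃ C₁ : ℝ} (hA' : 0 < A') (hθ' : 0 < θ') (hle : θ' ≤ α)
    (hχ : 0 ≤ χ) (hξ : 0 ≤ ξ₃) (hE : (α / A') ^ 2 * χ * ξ₃ ≤ C₁) :
    (θ' / A') ^ 2 * χ * ξ₃ ≤ C₁ := by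
  have h1 : θ' / A' ≤ α / A' := div_le_div_of_nonneg_right hle hA'.le
  have h0 : 0 ≤ θ' / A' := div_nonneg hθ'.le hA'.le
  have h2 : (θ' / A') ^ 2 ≤ (α / A') ^ 2 := pow_le_pow_left₀ h0 h1 2
  have h3 : (θ' / A') ^ 2 * χ * ξ₃ ≤ (α / A') ^ 2 * χ * ξ₃ :=
    mul_le_mul_of_nonneg_right (mul_le_mul_of_nonneg_right h2 hχ) hξ
  exact h3.trans hE

/-! ### The reduction -/

/-- **GAP ⇐ EDGE + S1r + S2χ₁ (the composition of line `registered`, sorry-free).**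
`YangLeeEdgeHyperscaling` (route item stmt-CriticalPhenomena-4946, by name) together with the two
open cores of the line — the first-zero rate S1r (`stub_firstZeroRate`: `α₁(Λ_L,β) ≤ A·α₁(Λ_n,β)` for
all `n` once `L ≥ K₀ξ(β)`, `β ∈ [β₀,β_c)`) and the one-scale susceptibility comparability S2χ₁
(`stub_susceptibilityComparabilityOneScale`: `Σ_{z∈Λ_n}⟨σ₀σ_z⟩⁺_{β_c} ≤ A·χ(β)` for `n ≤ rξ(β)`,
`β ∈ [β₂,β_c)`), both stated verbatim as hypotheses — imply the crux `NearCriticalLeeYangGap`; the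
landed pieces S1u, S2g, S1t, S1a, S1v, S1e, S2d are used inside. With
`β₁ := max(β₀, β₀', β₀'', β₂, β_c(3)/2)`: given `L₀`, S1u gives `β ∈ [β₁, β_c)` with
`ξ(β) ≥ max 1 (L₀/K₀ + 1)`; `L := ⌈K₀ξ(β)⌉₊ ≥ L₀`; S1a gives the cube zero `α = α₁(Λ_L,β) > 0`, S1v and
S1t a zero `θ' ∈ (0, α]` of the infinite-volume block characteristic function at `β`; S1r and S1e give
analyticity of `m(β,·)` on `{|Im h| < cα/A}`, EDGE then `(cα/A)²χξ³ ≤ C₁`, S2 (`= S2g (S2d S2χ₁)` at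
window constant `K₀+1`) `Σ_L ≤ Bχξ³`, whence `θ'²Σ_L ≤ (A/c)²BC₁`. -/
theorem nearCriticalLeeYangGap_of_edge_of_firstZeroRate_of_oneScale
    (hE : YangLeeEdgeHyperscaling)
    (hR : ∃ A K₀ β₀ : ℝ, 0 < A ∧ 0 < K₀ ∧ β₀ < Literature.Probability.LatticeModels.criticalBeta 3 ∧
      ∀ β : ℝ, β₀ ≤ β → β < Literature.Probability.LatticeModels.criticalBeta 3 → ∀ L : ℕ,
        K₀ * Literature.Probability.LatticeModels.isingCorrLength 3 β ≤ (L : ℝ) → ∀ n : ℕ,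
          Literature.Probability.LatticeModels.JiangNewman.firstZero 3
              (Literature.Probability.LatticeModels.box 3 L) β ≤
            A * Literature.Probability.LatticeModels.JiangNewman.firstZero 3
              (Literature.Probability.LatticeModels.box 3 n) β)
    (hχ₁ : ∃ r A β₂ : ℝ, 0 < r ∧ 0 < A ∧ β₂ < Literature.Probability.LatticeModels.criticalBeta 3 ∧
      ∀ β : ℝ, β₂ ≤ β → β < Literature.Probability.LatticeModels.criticalBeta 3 → ∀ n : ℕ,
        (n : ℝ) ≤ r * Literature.Probability.LatticeModels.isingCorrLength 3 β →
        ∑ z ∈ Literature.Probability.LatticeModels.box 3 n,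
            Literature.Probability.LatticeModels.twoPointPlus 3
              (Literature.Probability.LatticeModels.criticalBeta 3) z ≤
          A * (Literature.Probability.LatticeModels.susceptibility 3 β).toReal) :
    NearCriticalLeeYangGap := by
  -- S2χ := S2d S2χ₁ (landed p155937), S2 := S2g S2χ at window constant `K₀ + 1` (landed p149939)
  have hχ := stub_susceptibilityComparability_of_oneScale hχ₁
  obtain ⟨C₁, β₀, hβ₀, hE⟩ := hE
  obtain ⟨A, K₀, β₀', hApos, hK₀, hβ₀', hR⟩ := hR
  -- S1e (landed p154953)
  obtain ⟨c, β₀'', hc, hβ₀'', hA⟩ := stub_edgeAnalyticity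
  obtain ⟨B, β₂, hB, hβ₂, hW⟩ :=
    stub_criticalWindowVariance_of_susceptibilityComparability hχ (K₀ + 1) (by positivity)
  have hβc : 0 < criticalBeta 3 := criticalBeta_pos_holds (d := 3) (by norm_num)
  have hβ₁ : max (max (max (max β₀ β₀') β₀'') β₂) (criticalBeta 3 / 2) < criticalBeta 3 :=
    max_lt (max_lt (max_lt (max_lt hβ₀ hβ₀') hβ₀'') hβ₂) (by linarith)
  refine ⟨(A / c) ^ 2 * B * C₁, Filter.frequently_atTop.2 fun L₀ => ?_⟩
  -- S1u (landed p149697): a `β ∈ [β₁, β_c)` with a large correlation length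
  obtain ⟨β, hβ₁β, hββc, hξ⟩ := stub_corrLengthUnbounded
    (max (max (max (max β₀ β₀') β₀'') β₂) (criticalBeta 3 / 2)) (max 1 ((L₀ : ℝ) / K₀ + 1)) hβ₁
  have hm4 : max (max (max β₀ β₀') β₀'') β₂ ≤ β := le_trans (le_max_left _ _) hβ₁β
  have hm3 : max (max β₀ β₀') β₀'' ≤ β := le_trans (le_max_left _ _) hm4
  have hm2 : max β₀ β₀' ≤ β := le_trans (le_max_left _ _) hm3
  have hβ₀β : β₀ ≤ β := le_trans (le_max_left _ _) hm2
  have hβ₀'β : β₀' ≤ β := le_trans (le_max_right _ _) hm2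
  have hβ₀''β : β₀'' ≤ β := le_trans (le_max_right _ _) hm3
  have hβ₂β : β₂ ≤ β := le_trans (le_max_right _ _) hm4
  have hβpos : 0 < β := lt_of_lt_of_le (by linarith) (le_trans (le_max_right _ _) hβ₁β)
  have h0β : 0 ≤ β := hβpos.le
  obtain ⟨hL₀L, hKξL, hLKξ⟩ := gap_blockSize_window (L₀ := L₀) hK₀ (le_trans (le_max_left _ _) hξ)
    (le_trans (le_max_right _ _) hξ)
  -- S1a (landed p153649): the cube zero; S1v (p154053) and S1t (p153642): its transfer to the
  -- infinite-volume block
  obtain ⟨hαpos, hαzero⟩ := stub_firstZeroAttained ⌈K₀ * isingCorrLength 3 β⌉₊ β h0β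
  have hfin : ∀ N : ℕ, ⌈K₀ * isingCorrLength 3 β⌉₊ ≤ N → ∃ t : ℝ, 0 < t ∧
      t ≤ JiangNewman.firstZero 3 (box 3 ⌈K₀ * isingCorrLength 3 β⌉₊) β ∧
      isingExpect (zdGraph 3) (box 3 N) β 0 .free (fun σ => Real.cos (t *
        ∑ x ∈ box 3 ⌈K₀ * isingCorrLength 3 β⌉₊, spinAt x σ)) = 0 :=
    fun N hLN => stub_cubeZeroToFreeBox _ N β _ hLN h0β hαpos hαzero
  obtain ⟨θ', hθ'pos, hθ'le, hzero⟩ :=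
    stub_blockZeroOfFreeBoxZeros _ β _ h0β hββc.le hαpos hfin
  -- S1r (hypothesis): rate; S1e: strip analyticity; then EDGE (hypothesis)
  have hw : ∀ n : ℕ, JiangNewman.firstZero 3 (box 3 ⌈K₀ * isingCorrLength 3 β⌉₊) β / A ≤
      JiangNewman.firstZero 3 (box 3 n) β := fun n => by
    have h := hR β hβ₀'β hββc _ hKξL n
    rw [div_le_iff₀ hApos]
    linarith [h]
  obtain ⟨F, hF, hFm⟩ := hA β hβ₀''β hββc _ (div_pos hαpos hApos) hw
  have hEdge := hE β (c * (JiangNewman.firstZero 3 (box 3 ⌈K₀ * isingCorrLength 3 β⌉₊) β / A))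
    hβ₀β hββc (by positivity) ⟨F, hF, hFm⟩
  have heq : c * (JiangNewman.firstZero 3 (box 3 ⌈K₀ * isingCorrLength 3 β⌉₊) β / A) =
      JiangNewman.firstZero 3 (box 3 ⌈K₀ * isingCorrLength 3 β⌉₊) β / (A / c) := by
    rw [div_div_eq_mul_div]; ring
  rw [heq] at hEdge
  have hξpos : 0 < isingCorrLength 3 β := isingCorrLength_pos hβpos hββc
  have hEdge' := gap_edge_mono (div_pos hApos hc) hθ'pos hθ'le ENNReal.toReal_nonneg
    (pow_nonneg hξpos.le 3) hEdge
  -- S2 at `(β, L)` (critical-window variance) and the bookkeeping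
  have hVar := hW β hβ₂β hββc _ hLKξ
  exact ⟨_, hL₀L, β, θ', h0β, hββc.le, hθ'pos,
    gap_sq_mul_le_of_window_of_edge (div_pos hApos hc) hB hVar hEdge', hzero⟩

/-- **S3 — the registered glue stub `stub_gapOfEdgeRateOneScale` of line `registered`, verbatim**
(skeleton v7 of crux `NearCriticalLeeYangGap`): EDGE → S1r → S2χ₁ → GAP, all four written out; it is
`nearCriticalLeeYangGap_of_edge_of_firstZeroRate_of_oneScale` with anonymous hypotheses. -/
theorem stub_gapOfEdgeRateOneScale :
    Summit.CriticalPhenomena.Ising3DConformalLimit.Theses.LeeYangGap.YangLeeEdgeHyperscaling →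
    (∃ A K₀ β₀ : ℝ, 0 < A ∧ 0 < K₀ ∧ β₀ < Literature.Probability.LatticeModels.criticalBeta 3 ∧
      ∀ β : ℝ, β₀ ≤ β → β < Literature.Probability.LatticeModels.criticalBeta 3 → ∀ L : ℕ,
        K₀ * Literature.Probability.LatticeModels.isingCorrLength 3 β ≤ (L : ℝ) → ∀ n : ℕ,
          Literature.Probability.LatticeModels.JiangNewman.firstZero 3
              (Literature.Probability.LatticeModels.box 3 L) β ≤
            A * Literature.Probability.LatticeModels.JiangNewman.firstZero 3
              (Literature.Probability.LatticeModels.box 3 n) β) →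
    (∃ r A β₂ : ℝ, 0 < r ∧ 0 < A ∧ β₂ < Literature.Probability.LatticeModels.criticalBeta 3 ∧
      ∀ β : ℝ, β₂ ≤ β → β < Literature.Probability.LatticeModels.criticalBeta 3 → ∀ n : ℕ,
        (n : ℝ) ≤ r * Literature.Probability.LatticeModels.isingCorrLength 3 β →
        ∑ z ∈ Literature.Probability.LatticeModels.box 3 n,
            Literature.Probability.LatticeModels.twoPointPlus 3
              (Literature.Probability.LatticeModels.criticalBeta 3) z ≤
          A * (Literature.Probability.LatticeModels.susceptibility 3 β).toReal) →
    Summit.CriticalPhenomena.Ising3DConformalLimit.Theses.LeeYangGap.NearCriticalLeeYangGap :=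
  fun hE hR hχ₁ => nearCriticalLeeYangGap_of_edge_of_firstZeroRate_of_oneScale hE hR hχ₁

end Summit.CriticalPhenomena.Ising3DConformalLimit.LeeYangGapNearCriticalLeeYangGap

end
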